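import Literature.AlgebraicGeometry.Frobenioids.BaseCategoryTheoreticity
import Literature.AlgebraicGeometry.Frobenioids.CategoriesSquaresOneObjectWitness
import HarnessLib

/-!
# Frobenioids I, §0 / Cor. 4.11 (ii): functoriality of `1`-unique `1`-commutative squares

Mochizuki, *The geometry of Frobenioids I: the general theory*, Kyushu J. Math. **62** (2008) 293–400,
kurims text: §0 "1-commutative diagrams" p. 15 ("there exists a `1`-unique functor … that fits into a
`1`-commutative diagram") [cite: MochizukiFrdI2008, §0 p.15]; Cor. 4.11 (ii) p. 91 ("a `1`-unique functor
`Ψ^Base : D₁ → D₂`") [cite: MochizukiFrdI2008, Cor. 4.11 (ii) p.91].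

PROOF-ONLY file (cell abc-iut, seat abc-iut-L6-t7; row «C53i/M2» of abc-iut-L5-t4's `SUBDAG-IUTchI-Cor53.md`),
pure category theory over abc-iut-L1-t3's `PreFrobenioidData.OneUniqueSquare T L R B`
(`B` an equivalence, `T ⋙ R ≅ L ⋙ B`, and every `B'` with `T ⋙ R ≅ L ⋙ B'` is `≅ B`).  What the `1`-uniqueness
clause buys — the content of the phrase "the natural map `Isom(C₁, C₂) → Isom(Base(C₁), Base(C₂))`" of the
consumers ([FrdI] Thm. 6.4 (i); [IUTchI] Cor. 5.3 (i)) — is recorded once, fully universe-polymorphically: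

* `nonempty_iso_of_iso_top` — `Ψ ↦ Ψ^Base` is constant (up to isomorphism) on isomorphism classes of `Ψ`
  (well-definedness on the "isomorphisms `C₁ → C₂`" of [IUTchI] §0);
* `nonempty_comp_iso` — `(Ψ₂₃ ∘ Ψ₁₂)^Base ≅ Ψ₂₃^Base ∘ Ψ₁₂^Base` (horizontal pasting + uniqueness);
* `nonempty_iso_id` — `(id)^Base ≅ id`;
* `nonempty_inverse_iso` — `(Ψ⁻¹)^Base` is quasi-inverse to `Ψ^Base`;
* transport of a `1`-unique square along equivalences / isomorphic functors at its four corners: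
  `of_iso_sides` (replace `L`, `R` by isomorphic functors), `of_equiv_top` (replace `C₁, C₂` by equivalent
  categories), `of_equiv_bot` (replace `D₁, D₂` by equivalent categories).

No definitions; no statement of the paper is restated or strengthened; nothing here is specific to the abc
programme and no side is taken on [IUTchIII] Cor. 3.12.
-/

namespace Literature.AlgebraicGeometry.Frobenioids

open CategoryTheory

universe v₁ v₂ v₃ v₄ v₅ v₆ u₁ u₂ u₃ u₄ u₅ u₆

namespace PreFrobenioidData

namespace OneUniqueSquare

variable {X₁ : Type u₁} [Category.{v₁} X₁] {X₂ : Type u₂} [Category.{v₂} X₂] {X₃ : Type u₃} [Category.{v₃} X₃]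
variable {Y₁ : Type u₄} [Category.{v₄} Y₁] {Y₂ : Type u₅} [Category.{v₅} Y₂] {Y₃ : Type u₆} [Category.{v₆} Y₃]

/-! ### The three clauses -/

/-- The bottom functor of a `1`-unique square is an equivalence. [cite: MochizukiFrdI2008, §0 p.15] -/
theorem isEquivalence {T : X₁ ⥤ X₂} {L : X₁ ⥤ Y₁} {R : X₂ ⥤ Y₂} {B : Y₁ ⥤ Y₂} (h : OneUniqueSquare T L R B) :
    B.IsEquivalence :=
  h.1

/-- The square `1`-commutes: `T ⋙ R ≅ L ⋙ B`. [cite: MochizukiFrdI2008, §0 p.15] -/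
theorem oneCommutes {T : X₁ ⥤ X₂} {L : X₁ ⥤ Y₁} {R : X₂ ⥤ Y₂} {B : Y₁ ⥤ Y₂} (h : OneUniqueSquare T L R B) :
    OneCommutes T R L B :=
  h.2.1

/-- `1`-uniqueness: any other bottom functor making the square `1`-commute is isomorphic to `B`.
[cite: MochizukiFrdI2008, §0 p.15] -/
theorem nonempty_iso {T : X₁ ⥤ X₂} {L : X₁ ⥤ Y₁} {R : X₂ ⥤ Y₂} {B : Y₁ ⥤ Y₂} (h : OneUniqueSquare T L R B)
    {B' : Y₁ ⥤ Y₂} (h' : OneCommutes T R L B') : Nonempty (B' ≅ B) :=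
  h.2.2 B' h'

/-! ### Well-definedness on isomorphism classes, composition, identity, inverse -/

/-- **`Ψ ↦ Ψ^Base` is well defined on isomorphism classes**: the bottom functors of `1`-unique squares over
isomorphic top functors (same sides) are isomorphic. [cite: MochizukiFrdI2008, Cor. 4.11 (ii) p.91] -/
theorem nonempty_iso_of_iso_top {T T' : X₁ ⥤ X₂} {L : X₁ ⥤ Y₁} {R : X₂ ⥤ Y₂} {B B' : Y₁ ⥤ Y₂}
    (h : OneUniqueSquare T L R B) (h' : OneUniqueSquare T' L R B') (e : T ≅ T') : Nonempty (B ≅ B') :=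
  h'.nonempty_iso (h.oneCommutes.of_iso e (Iso.refl _) (Iso.refl _) (Iso.refl _))

/-- **Composition law** `(Ψ₂₃ ∘ Ψ₁₂)^Base ≅ Ψ₂₃^Base ∘ Ψ₁₂^Base`: the horizontal pasting of the two squares
`1`-commutes over `T₁₂ ⋙ T₂₃`, so `1`-uniqueness of the square of the composite identifies its bottom functor
with `B₁₂ ⋙ B₂₃`. [cite: MochizukiFrdI2008, Cor. 4.11 (ii) p.91] -/
theorem nonempty_comp_iso {T₁₂ : X₁ ⥤ X₂} {T₂₃ : X₂ ⥤ X₃} {L : X₁ ⥤ Y₁} {M : X₂ ⥤ Y₂} {R : X₃ ⥤ Y₃}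
    {B₁₂ : Y₁ ⥤ Y₂} {B₂₃ : Y₂ ⥤ Y₃} {B₁₃ : Y₁ ⥤ Y₃}
    (h₁₂ : OneUniqueSquare T₁₂ L M B₁₂) (h₂₃ : OneUniqueSquare T₂₃ M R B₂₃)
    (h₁₃ : OneUniqueSquare (T₁₂ ⋙ T₂₃) L R B₁₃) : Nonempty (B₁₂ ⋙ B₂₃ ≅ B₁₃) :=
  h₁₃.nonempty_iso (h₁₂.oneCommutes.hcomp h₂₃.oneCommutes)

/-- **Identity law** `(id)^Base ≅ id`: the identity functor fits the square over the identity, so the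
`1`-unique bottom functor is isomorphic to it. [cite: MochizukiFrdI2008, Cor. 4.11 (ii) p.91] -/
theorem nonempty_iso_id {L : X₁ ⥤ Y₁} {B : Y₁ ⥤ Y₁} (h : OneUniqueSquare (𝟭 X₁) L L B) :
    Nonempty (B ≅ 𝟭 Y₁) :=
  ⟨(h.nonempty_iso (oneCommutes_id_ends L)).some.symm⟩

/-- **Inverse law**: if `B` is the `1`-unique bottom functor over an equivalence `Ψ` and `B'` the one over
`Ψ⁻¹` (sides exchanged), then `B'` is a quasi-inverse of `B`. [cite: MochizukiFrdI2008, Cor. 4.11 (ii) p.91] -/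
theorem nonempty_inverse_iso {Ψ : X₁ ≌ X₂} {L : X₁ ⥤ Y₁} {R : X₂ ⥤ Y₂} {B : Y₁ ⥤ Y₂} {B' : Y₂ ⥤ Y₁}
    (h : OneUniqueSquare Ψ.functor L R B) (h' : OneUniqueSquare Ψ.inverse R L B') :
    Nonempty (B ⋙ B' ≅ 𝟭 Y₁) ∧ Nonempty (B' ⋙ B ≅ 𝟭 Y₂) := by
  haveI := h.isEquivalence
  -- the square of inverses `Ψ⁻¹ ⋙ L ≅ R ⋙ B⁻¹` `1`-commutes, so `B' ≅ B⁻¹`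
  have hinv : OneCommutes Ψ.inverse L R B.asEquivalence.inverse :=
    OneCommutes.inverse (Ψ := Ψ) (E := B.asEquivalence) h.oneCommutes
  obtain ⟨i⟩ := h'.nonempty_iso hinv
  exact ⟨⟨Functor.isoWhiskerLeft B i.symm ≪≫ B.asEquivalence.unitIso.symm⟩,
    ⟨Functor.isoWhiskerRight i.symm B ≪≫ B.asEquivalence.counitIso⟩⟩

/-! ### Transport along isomorphic sides and equivalent corners -/

/-- A `1`-unique square stays `1`-unique when its two side functors are replaced by isomorphic ones.
[cite: MochizukiFrdI2008, §0 p.15] -/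
theorem of_iso_sides {T : X₁ ⥤ X₂} {L L' : X₁ ⥤ Y₁} {R R' : X₂ ⥤ Y₂} {B : Y₁ ⥤ Y₂} (h : OneUniqueSquare T L R B)
    (iL : L ≅ L') (iR : R ≅ R') : OneUniqueSquare T L' R' B :=
  ⟨h.isEquivalence, h.oneCommutes.of_iso (Iso.refl _) iR iL (Iso.refl _),
    fun _ h' => h.nonempty_iso (h'.of_iso (Iso.refl _) iR.symm iL.symm (Iso.refl _))⟩

/-- A `1`-unique square stays `1`-unique when its top corners are replaced by EQUIVALENT categories:
given `e_i : X_i' ≌ X_i` and a top functor `T'` over `T` (`e₁ ⋙ T ≅ T' ⋙ e₂`), the square with top `T'`,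
sides `e₁ ⋙ L`, `e₂ ⋙ R` and the same bottom functor is `1`-unique. [cite: MochizukiFrdI2008, §0 p.15] -/
theorem of_equiv_top {X₁' : Type u₃} [Category.{v₃} X₁'] {X₂' : Type u₆} [Category.{v₆} X₂']
    {T : X₁ ⥤ X₂} {L : X₁ ⥤ Y₁} {R : X₂ ⥤ Y₂} {B : Y₁ ⥤ Y₂} (h : OneUniqueSquare T L R B)
    (e₁ : X₁' ≌ X₁) (e₂ : X₂' ≌ X₂) {T' : X₁' ⥤ X₂'} (i : e₁.functor ⋙ T ≅ T' ⋙ e₂.functor) :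
    OneUniqueSquare T' (e₁.functor ⋙ L) (e₂.functor ⋙ R) B := by
  refine ⟨h.isEquivalence, ?_, fun B' ⟨j⟩ => h.nonempty_iso ?_⟩
  · -- `T' ⋙ e₂ ⋙ R ≅ e₁ ⋙ T ⋙ R ≅ e₁ ⋙ L ⋙ B`
    obtain ⟨c⟩ := h.oneCommutes
    exact ⟨(Functor.associator T' e₂.functor R).symm ≪≫ Functor.isoWhiskerRight i.symm R ≪≫
      Functor.associator e₁.functor T R ≪≫ Functor.isoWhiskerLeft e₁.functor c ≪≫
      (Functor.associator e₁.functor L B).symm⟩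
  · -- from `T' ⋙ e₂ ⋙ R ≅ e₁ ⋙ L ⋙ B'` back down: `T ≅ e₁⁻¹ ⋙ T' ⋙ e₂`
    have i' : T ≅ e₁.inverse ⋙ T' ⋙ e₂.functor :=
      (e₁.invFunIdAssoc T).symm ≪≫ Functor.isoWhiskerLeft e₁.inverse i
    exact ⟨Functor.isoWhiskerRight i' R ≪≫ Functor.associator e₁.inverse (T' ⋙ e₂.functor) R ≪≫
      Functor.isoWhiskerLeft e₁.inverse (Functor.associator T' e₂.functor R ≪≫ j ≪≫
        Functor.associator e₁.functor L B') ≪≫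
      e₁.invFunIdAssoc (L ⋙ B')⟩

/-- A `1`-unique square stays `1`-unique when its bottom corners are replaced by EQUIVALENT categories:
given `f_i : Y_i ≌ Y_i'`, the square with sides `L ⋙ f₁`, `R ⋙ f₂` and bottom functor `f₁⁻¹ ⋙ B ⋙ f₂` is
`1`-unique. [cite: MochizukiFrdI2008, §0 p.15] -/
theorem of_equiv_bot {Y₁' : Type u₃} [Category.{v₃} Y₁'] {Y₂' : Type u₆} [Category.{v₆} Y₂']
    {T : X₁ ⥤ X₂} {L : X₁ ⥤ Y₁} {R : X₂ ⥤ Y₂} {B : Y₁ ⥤ Y₂} (h : OneUniqueSquare T L R B)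
    (f₁ : Y₁ ≌ Y₁') (f₂ : Y₂ ≌ Y₂') :
    OneUniqueSquare T (L ⋙ f₁.functor) (R ⋙ f₂.functor) (f₁.inverse ⋙ B ⋙ f₂.functor) := by
  haveI := h.isEquivalence
  refine ⟨inferInstance, ?_, fun B' ⟨j⟩ => ?_⟩
  · -- `T ⋙ R ⋙ f₂ ≅ L ⋙ B ⋙ f₂ ≅ L ⋙ f₁ ⋙ f₁⁻¹ ⋙ B ⋙ f₂`
    obtain ⟨c⟩ := h.oneCommutes
    exact ⟨(Functor.associator T R f₂.functor).symm ≪≫ Functor.isoWhiskerRight c f₂.functor ≪≫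
      Functor.associator L B f₂.functor ≪≫
      Functor.isoWhiskerLeft L (f₁.funInvIdAssoc (B ⋙ f₂.functor)).symm ≪≫
      (Functor.associator L f₁.functor (f₁.inverse ⋙ B ⋙ f₂.functor)).symm⟩
  · -- `K := f₁ ⋙ B' ⋙ f₂⁻¹` fits the original square, hence `K ≅ B`; conjugate back
    have j' : T ⋙ R ≅ L ⋙ (f₁.functor ⋙ B' ⋙ f₂.inverse) :=
      (Functor.rightUnitor (T ⋙ R)).symm ≪≫ Functor.isoWhiskerLeft (T ⋙ R) f₂.unitIso ≪≫
        (Functor.associator (T ⋙ R) f₂.functor f₂.inverse).symm ≪≫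
        Functor.isoWhiskerRight (Functor.associator T R f₂.functor ≪≫ j) f₂.inverse ≪≫
        Functor.associator (L ⋙ f₁.functor) B' f₂.inverse ≪≫
        Functor.associator L f₁.functor (B' ⋙ f₂.inverse)
    obtain ⟨k⟩ := h.nonempty_iso ⟨j'⟩
    -- `B' ≅ f₁⁻¹ ⋙ f₁ ⋙ B' ⋙ f₂⁻¹ ⋙ f₂ ≅ f₁⁻¹ ⋙ B ⋙ f₂`
    exact ⟨(f₁.invFunIdAssoc B').symm ≪≫
      Functor.isoWhiskerLeft f₁.inverse (Functor.isoWhiskerLeft f₁.functor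
        ((Functor.rightUnitor B').symm ≪≫ Functor.isoWhiskerLeft B' f₂.counitIso.symm ≪≫
          (Functor.associator B' f₂.inverse f₂.functor).symm)) ≪≫
      Functor.isoWhiskerLeft f₁.inverse
        ((Functor.associator f₁.functor (B' ⋙ f₂.inverse) f₂.functor).symm ≪≫
          Functor.isoWhiskerRight ((Functor.associator f₁.functor B' f₂.inverse).symm ≪≫ k) f₂.functor)⟩

end OneUniqueSquare

end PreFrobenioidData

end Literature.AlgebraicGeometry.Frobenioids
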